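import Summits.BirchSwinnertonDyer.BirchSwinnertonDyer.Theorems.ByReductionTypeAtTwoSupersingularHondaSystemAtTwoSprungIso
import Summits.BirchSwinnertonDyer.BirchSwinnertonDyer.Theorems.ByReductionTypeAtTwoSupersingularHondaSystemAtTwoSprungGenStep
import Summits.BirchSwinnertonDyer.BirchSwinnertonDyer.Theorems.ByReductionTypeAtTwoSupersingularHondaSystemAtTwoSprungPoints
import Summits.BirchSwinnertonDyer.BirchSwinnertonDyer.Theorems.PrintX8VSInputHondaSystemPadicModel
import Mathlib.Tactic.Module
import HarnessLib

/-!
# Sprung's Honda system AT `p = 2`, VII: the PRIMAL Honda data over `ℚ_[2]` for EVERY globally minimal `W/ℚ` with good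
# supersingular reduction at `2` (`a₂ ∈ {0, ±2}`) — Sprung plus points, the typed bottom constants, (GEN), (NONDIV)

Seat `bsd-2adic-tower-1` GEN 66, hand H2-C1 (pen GEN 40 SUMMON 20260831T155847Z); crux `SupersingularRankZeroAtTwo`
(item stmt-BirchSwinnertonDyer-19097), line `odd_blind_package` v2.14: stub 2's conjuncts (1)–(6) follow from (C1) BY NAME
(`SSFlatLocalData.flatLocalData_of_hondaSystemAtTwoExists`, p827135). Assembly of files I (`…Dual`), IV (`…SprungIso`), V (`…SprungGenStep`),
VI (`…SprungPoints`) with the tree's 2-adic model, layer torsion, layer dictionary and model transport (K3 `SignedKatoOffTwo.*`, TP2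
`SignedEC.*`).

CONSTRUCTION (Sprung 2012 Thm. 2.2 READ AT `2`, cell memo MEMO-imc §10.90 / REF1 §139 (B0), R1–R3). `a := a₂(W)`, `M_W` the `ℤ₂`-model,
`x_0 = 1`, `2x_1 = a`, `2x_{k+2} = a x_{k+1} − x_k` (`‖x_k‖ ≤ √2^k`, R1), `ℓ(X) = ∑ₖ x_k((1+X)^{2^k} − 1)` of Honda type `2 − aT + T²` (R2) as
is `log_E` at every prime ⟹ an integral Honda pair `(i, j)` (IV); tower points `y_m ∈ E(ℚ₂(ζ_{2^m})) ∩ Ê`, `Λ(y_m) = ℓ(ζ_{2^m} − 1)`;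
inverters `σ_m`; PLUS POINTS `e_n = y_{n+2} + σ_{n+2}•y_{n+2} ∈ E(ℚ_{2,n})`; `N₁ = #Ẽ(𝔽₂) = 3 − a` (odd); **`cneg := −y_1`** (`Λ = 2`),
**`c_n := N₁•e_n − 2•y_1`**. Then (VI + `module`): `c_0 = (a² − 2a − 1)•cneg`, `Tr_{1/0} c_1 = a•c_0 + (4 − 2a)•cneg`,
`Tr_{n+1/n} c_{n+1} = a•c_n − c_{n−1}` (R3, EXACTLY the typed constants); (GEN) from V via `E₁`-saturation by the odd `N₁` and the
generator change `N₁•e_n = c_n + 2•y_1`; (NONDIV) `cneg ∉ 2E(ℚ₂)`; transport `ℚ_[2] → ℚ_v`; (GEN₀) by Milne I 3.3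
(`SignedEC.plusGenZero_two_of_ne_two_nsmul`); the four dual clauses by `SSHondaTwo.isHondaSystemAtTwo_of_primal` (I).

WHAT (THEOREMS ONLY; no definition, no named fact, no instance, no `sorry`; route-independent — no `Theses` import):
`plusGen_of_plusGen_generator_change_odd` and ★ `sprungPrimal_padic` — the PRIMAL Honda data at `ℚ_[2]` for every `ι` and every
even `a₂` (levels, the three relations with the typed constants, (GEN), (NONDIV)). The transport to `ℚ_v` and the conclusion
`F1Sign2.HondaSystemAtTwoExists` are the sequel `…SupersingularHondaSystemAtTwoExists`.
HONEST FRAMING: (C1) is a LOCAL existence statement (a binder of stub 2 of line `odd_blind_package`); it closes no stub and no item by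
itself; nothing booked; BSD is proved for no curve by any of this.

References: [Sprung2012] F. Sprung, J. Number Theory 132 (2012), Thm. 2.2 (pp. 1486–1487), Cor. 2.10, Lemma 2.3; [Kobayashi2003]
S. Kobayashi, Invent. Math. 152 (2003), §8 (Thm. 8.3–8.4, Lemma 8.9, Props. 8.7, 8.11, 8.12); [Honda1970] Thm. 2, Thm. 9;
[KuriharaOtsuki2006] p. 557, Prop. 1.4; [MilneADT2006] I Lemma 3.3; [Washington1997] §13.1; [SerreGaloisCohomology1997] II.§1.1.
-/

set_option autoImplicit false
-- the Theorems namespace of this sub repeats the summit name by design (D-0017 nested layout)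
set_option linter.dupNamespace false

noncomputable section

open scoped Classical IntermediateField Topology NNReal NumberField
open Filter PowerSeries Finset

namespace Summit.BirchSwinnertonDyer.BirchSwinnertonDyer.Theorems.SSHondaTwo

open Field WeierstrassCurve NumberField IsDedekindDomain Literature.NumberTheory.EllipticCurves
  Literature.NumberTheory.GaloisRepresentations Literature.RingTheory.FormalGroups
  Literature.NumberTheory.EllipticCurves.ZpExtension Literature.NumberTheory.EllipticCurves.Kobayashi2003
  Literature.NumberTheory.EllipticCurves.FormalGroupChart Literature.NumberTheory.EllipticCurves.Rank1Residual
  Summit.BirchSwinnertonDyer.Rank1Residual.Additive Summit.BirchSwinnertonDyer.Rank1Residual.Additive.PadicCyclotomicTower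
  Summit.BirchSwinnertonDyer.Rank1Residual.Additive.BallEval Summit.BirchSwinnertonDyer.Rank1Residual.Additive.HondaFss
  Summit.BirchSwinnertonDyer.Rank1Residual.Additive.LocalTransport
  Summit.BirchSwinnertonDyer.BirchSwinnertonDyer.Theorems.SignedKatoOffTwo.LocalAllPrimes
  Summit.BirchSwinnertonDyer.BirchSwinnertonDyer.Theorems.SignedKatoOffTwo.LocalTwo
  Summit.BirchSwinnertonDyer.BirchSwinnertonDyer.Theorems.SignedEC
  Summit.BirchSwinnertonDyer.BirchSwinnertonDyer.Theorems.SignedEC.PlusLayer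
  Summit.BirchSwinnertonDyer.BirchSwinnertonDyer.Theorems.SignedEC.PlusTower

/-! ## §1 Generator change for the (GEN) clause with an ODD multiplier -/

section GeneratorChange

variable {G : Type*} [Group G] {A : Type*} [AddCommGroup A] [DistribMulAction G A]

/-- **Generator change with an odd multiplier.** If `k•P ∈ ℤ[G·e] + H' + 2H` (`P ∈ H`) and `k•e = d + 2•c` with `c ∈ H'`, `H'`
stable under `G`, `k` ODD, then `P ∈ ℤ[G·d] + H' + 2H` (`k·(kP) ∈ ℤ[G·d] + H' + 2H` and `k² ≡ 1 (mod 2)`). The tree's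
`SignedEC.PlusLayer.plusGen_of_plusGen_generator_change` is `k = 3`; at `a₂ = ±2` the multiplier is `#Ẽ(𝔽₂) ∈ {1, 5}`.
[cite: Kobayashi2003, Prop. 8.12] -/
theorem plusGen_of_plusGen_generator_change_odd {H H' : AddSubgroup A} (hH' : ∀ (g : G) {x : A}, x ∈ H' → g • x ∈ H')
    {k : ℕ} (hk : Odd k) {e d c : A} (hedc : k • e = d + 2 • c) (hc : c ∈ H') {P : A} (hP : P ∈ H)
    (h : ∃ B ∈ AddSubgroup.closure (Set.range fun g : G ↦ g • e), ∃ P' ∈ H', ∃ R ∈ H, k • P = B + P' + 2 • R) :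
    ∃ B ∈ AddSubgroup.closure (Set.range fun g : G ↦ g • d), ∃ P' ∈ H', ∃ R ∈ H, P = B + P' + 2 • R := by
  obtain ⟨B, hB, P', hP', R, hR, hPe⟩ := h
  -- `k • B = Bd + 2 • C` with `Bd ∈ ℤ[G·d]`, `C ∈ H'`
  have key : ∀ B₀ ∈ AddSubgroup.closure (Set.range fun g : G ↦ g • e),
      ∃ Bd ∈ AddSubgroup.closure (Set.range fun g : G ↦ g • d), ∃ C ∈ H', k • B₀ = Bd + 2 • C := by
    intro B₀ hB₀
    induction hB₀ using AddSubgroup.closure_induction with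
    | mem x hx =>
      obtain ⟨g, rfl⟩ := hx
      refine ⟨g • d, AddSubgroup.subset_closure ⟨g, rfl⟩, g • c, hH' g hc, ?_⟩
      have h3 : g • (k • e) = k • (g • e) := map_nsmul (DistribSMul.toAddMonoidHom A g) k e
      have h2 : g • (2 • c) = 2 • (g • c) := map_nsmul (DistribSMul.toAddMonoidHom A g) 2 c
      change k • (g • e) = g • d + 2 • (g • c)
      rw [← h3, hedc, smul_add, h2]
    | zero => exact ⟨0, AddSubgroup.zero_mem _, 0, H'.zero_mem, by simp⟩
    | add x y _ _ ihx ihy =>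
      obtain ⟨B₁, hB₁, C₁, hC₁, h₁⟩ := ihx
      obtain ⟨B₂, hB₂, C₂, hC₂, h₂⟩ := ihy
      refine ⟨B₁ + B₂, AddSubgroup.add_mem _ hB₁ hB₂, C₁ + C₂, H'.add_mem hC₁ hC₂, ?_⟩
      rw [nsmul_add, h₁, h₂, nsmul_add]; abel
    | neg x _ ih =>
      obtain ⟨B₁, hB₁, C₁, hC₁, h₁⟩ := ih
      refine ⟨-B₁, AddSubgroup.neg_mem _ hB₁, -C₁, H'.neg_mem hC₁, ?_⟩
      rw [smul_neg, h₁, smul_neg]; abel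
  obtain ⟨Bd, hBd, C, hC, hkB⟩ := key B hB
  obtain ⟨j, hj⟩ : ∃ j, k * k = 2 * j + 1 := by
    obtain ⟨i, rfl⟩ := hk
    exact ⟨2 * i * i + 2 * i, by ring⟩
  refine ⟨Bd, hBd, 2 • C + k • P', H'.add_mem (H'.nsmul_mem hC 2) (H'.nsmul_mem hP' k), k • R - j • P,
    H.sub_mem (H.nsmul_mem hR k) (H.nsmul_mem hP j), ?_⟩
  have hkkP : (k * k) • P = k • B + k • P' + (2 * k) • R := by
    rw [mul_nsmul, hPe, nsmul_add, nsmul_add, ← mul_nsmul, mul_comm]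
  have hPP : (k * k) • P - (2 * j) • P = P := by
    rw [hj, add_nsmul, one_nsmul, add_sub_cancel_left]
  calc P = (k * k) • P - (2 * j) • P := hPP.symm
    _ = k • B + k • P' + (2 * k) • R - (2 * j) • P := by rw [hkkP]
    _ = Bd + (2 • C + k • P') + 2 • (k • R - j • P) := by
        rw [hkB]; module

end GeneratorChange

/-! ## §2 The primal Honda data at `2` over `ℚ_[2]` (every `ι`, every even `a₂`) -/

/-- **PRIMAL Honda data at `2` over Mathlib's `ℚ_[2]`, every `ι`, EVERY `W` with `GoodSS W 2`** (`a = a₂(W) ∈ {0, ±2}`): points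
`cneg ∈ E(ℚ₂)`, `c_n ∈ E(ℚ_{2,n}·ℚ₂)` with the three relations of `F1Sign2.IsHondaSystemAtTwo` —
`c_0 = (a² − 2a − 1)•cneg`, `Tr_{1/0} c_1 = a•c_0 + (4 − 2a)•cneg`, `Tr_{n+1/n} c_{n+1} = a•c_n − c_{n−1}` (`n ≥ 1`) —, the
generation clause (GEN) for `m ≥ 1` (multiplier `1`), and (NONDIV) `cneg ∉ 2E(ℚ₂)`. Construction: module docstring.
[cite: Sprung2012, Thm. 2.2 (pp. 1486–1487), Lemma 2.3] [cite: Kobayashi2003, Lemma 8.9, Props. 8.11–8.12] [cite: KuriharaOtsuki2006, p. 557] -/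
theorem sprungPrimal_padic (W : WeierstrassCurve ℚ) [W.IsElliptic] [W.IsGloballyMinimal]
    (hss : GoodSS W 2) (κ : ZpExtension ℚ 2) (hκ : κ.IsCyclotomic) (ι : AlgebraicClosure ℚ →ₐ[ℚ] AlgebraicClosure ℚ_[2]) :
    ∃ (cneg : localPoints W ℚ_[2]) (d : ℕ → localPoints W ℚ_[2]),
      cneg ∈ localLayerPointsOfEmb κ ι W 0 ∧ (∀ m, d m ∈ localLayerPointsOfEmb κ ι W m) ∧
      d 0 = (W.frobeniusTrace 2 ^ 2 - 2 * W.frobeniusTrace 2 - 1) • cneg ∧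
      localTraceOfEmb κ ι W 0 1 (d 1) = W.frobeniusTrace 2 • d 0 + (4 - 2 * W.frobeniusTrace 2) • cneg ∧
      (∀ n : ℕ, 1 ≤ n → localTraceOfEmb κ ι W n (n + 1) (d (n + 1)) = W.frobeniusTrace 2 • d n - d (n - 1)) ∧
      (∀ m : ℕ, 1 ≤ m → ∀ P ∈ localLayerPointsOfEmb κ ι W m,
        ∃ B ∈ AddSubgroup.closure (Set.range fun σ : absoluteGaloisGroup ℚ_[2] ↦ σ • d m),
          ∃ P' ∈ localLayerPointsOfEmb κ ι W (m - 1), ∃ R ∈ localLayerPointsOfEmb κ ι W m, P = B + P' + 2 • R) ∧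
      (∀ b ∈ localLayerPointsOfEmb κ ι W 0, cneg ≠ 2 • b) := by
  haveI hFt : ∀ m, Fintype (stab 2 m ⧸ (stab 2 (m + 1)).subgroupOf (stab 2 m)) := fun m =>
    haveI := finite_stab_quot m; Fintype.ofFinite _
  set a : ℤ := W.frobeniusTrace 2 with ha_def
  have ha2 : (2 : ℤ) ∣ a := hss.2
  -- the `2`-adic model and its identification with `W ⊗ ℚ̄₂`
  set M : WeierstrassCurve ℤ_[2] := (integralModelInt W).map (Int.castRingHom ℤ_[2]) with hM
  haveI := isElliptic_coe_twoAdicModel W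
  haveI := isElliptic_toZMod_twoAdicModel W hss.1
  haveI hintΩ := isIntegral_genFib_baseChange 2 M
  set hV := (genFibΩ_eq_baseChange M).trans (baseChange_twoAdicModel W) with hVdef
  have htr : Literature.NumberTheory.EllipticCurves.HasseManin.tr (M.map PadicInt.toZMod) = a := by
    rw [hM, tr_twoAdicModel W hss.1]
  have h₁ := a₁_twoAdicModel_mem W hss
  -- the Sprung sequence `x 0 = 1`, `2 x 1 = a`, `2 x (k+2) = a x (k+1) − x k`
  let xs : ℕ → ℚ_[2] × ℚ_[2] := fun k ↦
    Nat.rec ((1 : ℚ_[2]), ((a : ℚ_[2]) / 2)) (fun _ q ↦ (q.2, ((a : ℚ_[2]) * q.2 - q.1) / 2)) k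
  let x : ℕ → ℚ_[2] := fun k ↦ (xs k).1
  have hx0 : x 0 = 1 := rfl
  have hx1 : ((2 : ℕ) : ℚ_[2]) * x 1 = a := by
    show ((2 : ℕ) : ℚ_[2]) * ((a : ℚ_[2]) / 2) = a
    push_cast; field_simp
  have hrec : ∀ k, ((2 : ℕ) : ℚ_[2]) * x (k + 2) = a * x (k + 1) - x k := by
    intro k
    show ((2 : ℕ) : ℚ_[2]) * (((a : ℚ_[2]) * (xs k).2 - (xs k).1) / 2) = a * (xs k).2 - (xs k).1
    push_cast; field_simp
  have ha : ‖((a : ℤ) : ℚ_[2])‖ ≤ ((2 : ℕ) : ℝ)⁻¹ := SprungHonda.norm_intCast_le_inv_of_dvd (p := 2) (by exact_mod_cast ha2)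
  have hxb : ∀ k, ‖x k‖ ≤ Real.sqrt (2 : ℕ) ^ k := SprungHonda.norm_sprungSeq_le ha hx0 hx1 hrec
  -- the logarithm of `F_ss` and the integral Honda isomorphism (file IV, every prime)
  have htr' : (Literature.NumberTheory.EllipticCurves.HasseManin.tr (M.map PadicInt.toZMod) : ℚ_[2]) = (a : ℚ_[2]) := by
    rw [htr]
  have hℓ : ∀ n, ‖coeff n (hondaShift 2 (Literature.NumberTheory.EllipticCurves.HasseManin.tr (M.map PadicInt.toZMod) : ℚ_[2])
      (PowerSeries.mk fun d ↦ ∑' k : ℕ, x k * ((((2 : ℕ) ^ k).choose d : ℚ_[2]) - if d = 0 then 1 else 0)))‖ ≤ 1 := fun n ↦ by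
    rw [htr']; exact SprungHonda.norm_coeff_hondaShift_sprungLog_le_one ha hx0 hx1 hrec n
  obtain ⟨i, j, hi0, hj0, hij, -, hlog⟩ :=
    exists_integral_hondaIso' M (SprungHonda.constantCoeff_sprungLog x) (SprungHonda.norm_coeff_one_sprungLog hx0 hxb) hℓ
  -- the tower points over `ℚ₂(ζ_{2^m})`
  obtain ⟨c, hc0, hcL, hck, hcΛ⟩ := SprungHonda.exists_sprungTowerPoints (M := M) hxb hi0 hlog
  -- inverters
  have hσex : ∀ m : ℕ, ∃ σ : absoluteGaloisGroup ℚ_[2], σ • zeta 2 (m + 1) = (zeta 2 (m + 1))⁻¹ :=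
    fun m ↦ exists_smul_zeta_eq_inv 2 (by omega)
  choose σ₀ hσ₀ using hσex
  set σ : ℕ → absoluteGaloisGroup ℚ_[2] := fun m ↦ σ₀ (m - 1) with hσ_def
  have hσ : ∀ m, 1 ≤ m → σ m • zeta 2 m = (zeta 2 m)⁻¹ := fun m hm ↦ by
    obtain ⟨k, rfl⟩ := Nat.exists_eq_add_of_le' hm
    simp only [hσ_def, Nat.add_sub_cancel]
    exact hσ₀ k
  -- `N₁ = #Ẽ(𝔽₂) = 3 − a`, odd
  set N₁ : ℕ := Nat.card (M.map PadicInt.toZMod).toAffine.Point with hN₁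
  have hN₁a : (N₁ : ℤ) = 3 - a := by
    have h := htr
    rw [Literature.NumberTheory.EllipticCurves.HasseManin.tr, ZMod.card] at h
    push_cast at h
    linarith
  have hN₁odd : Odd N₁ := by
    obtain ⟨b, hb⟩ := ha2
    refine Nat.odd_iff.mpr ?_
    omega
  have hN₁s : ∀ X : localPoints W ℚ_[2], N₁ • X = (3 - a) • X := fun X ↦ by rw [← natCast_zsmul, hN₁a]
  -- the points: `y_m = toLoc (c m)`, `e_n = y_{n+2} + σ_{n+2}•y_{n+2}`, `cneg = −y_1`, `d_n = N₁•e_n − 2•y_1`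
  have hy1fix : ∀ τ : absoluteGaloisGroup ℚ_[2], τ • toLoc hV (c 1) = toLoc hV (c 1) :=
    smul_toLoc_one_eq_of_mem_layer hV hcL
  have hy1L0 : toLoc hV (c 1) ∈ localLayerPointsOfEmb κ ι W 0 := (mem_localLayerPointsOfEmb_zero_iff κ ι W _).mpr hy1fix
  have heL : ∀ n, toLoc hV (c (n + 2)) + σ (n + 2) • toLoc hV (c (n + 2)) ∈ localLayerPointsOfEmb κ ι W n := fun n ↦
    add_smul_mem_localLayerPointsOfEmb_two_stab W ι hκ (hσ (n + 2) (by omega))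
      (fun τ hτ ↦ smul_toLoc_eq_of_mem_layer hV hcL (n + 2) hτ)
  have hL : ∀ n, N₁ • (toLoc hV (c (n + 2)) + σ (n + 2) • toLoc hV (c (n + 2))) - 2 • toLoc hV (c 1) ∈
      localLayerPointsOfEmb κ ι W n := fun n ↦
    sub_mem (AddSubgroup.nsmul_mem _ (heL n) N₁)
      (AddSubgroup.nsmul_mem _ (localLayerPointsOfEmb_mono κ ι W (Nat.zero_le n) hy1L0) 2)
  refine ⟨-toLoc hV (c 1), fun n ↦ N₁ • (toLoc hV (c (n + 2)) + σ (n + 2) • toLoc hV (c (n + 2))) - 2 • toLoc hV (c 1),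
    neg_mem hy1L0, hL, ?_, ?_, ?_, ?_, ?_⟩
  · -- `c_0 = (a² − 2a − 1) • cneg`
    show N₁ • (toLoc hV (c 2) + σ 2 • toLoc hV (c 2)) - 2 • toLoc hV (c 1) = _
    rw [sprungPlus_zero hV h₁ hx0 hx1 hrec hc0 hcL hck hcΛ (hσ 2 (by omega)), hN₁s]
    module
  · -- `Tr_{1/0} c_1 = a • c_0 + (4 − 2a) • cneg`
    have hy1s : ∀ τ ∈ stab 2 2, τ • toLoc hV (c 1) = toLoc hV (c 1) := fun τ _ ↦ hy1fix τ
    have key : ∑ q : stab 2 2 ⧸ (stab 2 (2 + 1)).subgroupOf (stab 2 2),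
        ((q.out : stab 2 2) : absoluteGaloisGroup ℚ_[2]) •
          (N₁ • (toLoc hV (c 3) + σ 3 • toLoc hV (c 3)) - 2 • toLoc hV (c 1)) =
        a • (N₁ • (toLoc hV (c 2) + σ 2 • toLoc hV (c 2)) - 2 • toLoc hV (c 1)) + (4 - 2 * a) • -toLoc hV (c 1) := by
      simp_rw [smul_sub, smul_comm _ N₁, smul_comm _ (2 : ℕ)]
      rw [Finset.sum_sub_distrib, ← Finset.smul_sum, ← Finset.smul_sum,
        sprungPlus_trace_one hV h₁ hx0 hx1 hrec hcL hck hcΛ hσ, sum_out_smul_eq_two_nsmul (by omega) hy1s]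
      simp only [hN₁s]
      generalize toLoc hV (c 2) + σ 2 • toLoc hV (c 2) = E₀
      module
    rw [localTraceOfEmb_two_eq_sum_stab ι W hκ (by omega : 0 ≤ 1) (hL 1)]
    convert key using 2
  · -- `Tr_{n+1/n} c_{n+1} = a • c_n − c_{n−1}` (`n ≥ 1`)
    intro n hn
    have hy1s : ∀ τ ∈ stab 2 (n + 2), τ • toLoc hV (c 1) = toLoc hV (c 1) := fun τ _ ↦ hy1fix τ
    have hidx : n - 1 + 2 = n + 1 := by omega
    have key : ∑ q : stab 2 (n + 2) ⧸ (stab 2 (n + 2 + 1)).subgroupOf (stab 2 (n + 2)),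
        ((q.out : stab 2 (n + 2)) : absoluteGaloisGroup ℚ_[2]) •
          (N₁ • (toLoc hV (c (n + 3)) + σ (n + 3) • toLoc hV (c (n + 3))) - 2 • toLoc hV (c 1)) =
        a • (N₁ • (toLoc hV (c (n + 2)) + σ (n + 2) • toLoc hV (c (n + 2))) - 2 • toLoc hV (c 1)) -
          (N₁ • (toLoc hV (c (n + 1)) + σ (n + 1) • toLoc hV (c (n + 1))) - 2 • toLoc hV (c 1)) := by
      simp_rw [smul_sub, smul_comm _ N₁, smul_comm _ (2 : ℕ)]
      rw [Finset.sum_sub_distrib, ← Finset.smul_sum, ← Finset.smul_sum,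
        sprungPlus_trace_succ hV h₁ hx0 hx1 hrec hcL hck hcΛ hσ hn, sum_out_smul_eq_two_nsmul (by omega) hy1s]
      simp only [hN₁s]
      generalize toLoc hV (c (n + 2)) + σ (n + 2) • toLoc hV (c (n + 2)) = E₂
      generalize toLoc hV (c (n + 1)) + σ (n + 1) • toLoc hV (c (n + 1)) = E₁
      module
    rw [localTraceOfEmb_two_eq_sum_stab ι W hκ (by omega : n ≤ n + 1) (hL (n + 1))]
    dsimp only
    rw [hidx]
    convert key using 2
  · -- (GEN) for `m ≥ 1`
    intro m hm Q hQ
    obtain ⟨m', rfl⟩ := Nat.exists_eq_add_of_le' hm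
    have htors : ∀ Q ∈ subfieldPoints (genFibΩ 2 M) (layer 2 (m' + 1 + 2)).toSubfield coeffs_mem_layer,
        ∀ k : ℕ, 2 ^ k • Q = 0 → Q = 0 :=
      fun Q hQ k hk ↦ eq_zero_of_two_pow_smul_eq_zero_of_mem_subfieldPoints_layer M h₁ _ hQ hk
    set act : absoluteGaloisGroup ℚ_[2] → (genFibΩ 2 M).toAffine.Point → (genFibΩ 2 M).toAffine.Point :=
      fun τ P ↦ (toLoc hV).symm (τ • toLoc hV P) with hact
    -- the plus point `e = c + σ c` at level `m' + 3`
    have hσ3 := hσ (m' + 3) (by omega)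
    set e := c (m' + 3) + act (σ (m' + 3)) (c (m' + 3)) with he
    have hacte : act (σ (m' + 3)) (c (m' + 3)) = (toLoc hV).symm (σ (m' + 3) • toLoc hV (c (m' + 3))) := rfl
    have he_toLoc : toLoc hV e = toLoc hV (c (m' + 3)) + σ (m' + 3) • toLoc hV (c (m' + 3)) := by
      rw [he, map_add, hacte, AddEquiv.apply_symm_apply]
    have heLayer : toLoc hV e ∈ localLayerPointsOfEmb κ ι W (m' + 1) := by rw [he_toLoc]; exact heL (m' + 1)
    have heL' : e ∈ subfieldPoints (genFibΩ 2 M) (ℚ_[2]⟮zeta 2 (m' + 1 + 2) + (zeta 2 (m' + 1 + 2))⁻¹ - 2⟯).toSubfield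
        (PlusTower.coeffs_mem_adjoin M _) := by
      have h := (mem_localLayerPointsOfEmb_two_iff_mem_subfieldPoints_adjoin_v hV ι hκ (m' + 1) (toLoc hV e)).mp heLayer
      rwa [AddEquiv.symm_apply_apply] at h
    have hactL : act (σ (m' + 3)) (c (m' + 3)) ∈ subfieldPoints (genFibΩ 2 M) (layer 2 (m' + 3)).toSubfield coeffs_mem_layer :=
      act_mem_subfieldPoints act (act_zero hV) (act_some hV) _ (hcL (m' + 3))
    have hactk : act (σ (m' + 3)) (c (m' + 3)) ∈ kernel (Valued.v (R := PadicAlgCl 2)) (genFibΩ 2 M) :=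
      act_mem_kernel act (act_zero hV) (act_some hV) _ (hck (m' + 3))
    have hek : e ∈ kernel (Valued.v (R := PadicAlgCl 2)) (genFibΩ 2 M) :=
      (kernel (Valued.v (R := PadicAlgCl 2)) (genFibΩ 2 M)).add_mem (hck (m' + 3)) hactk
    have heℓ : ptLogΩ 2 M e - (zeta 2 (m' + 1 + 2) + (zeta 2 (m' + 1 + 2))⁻¹ - 2) ∈
        ℚ_[2]⟮zeta 2 (m' + 1 + 1) + (zeta 2 (m' + 1 + 1))⁻¹ - 2⟯ := by
      haveI := isIntegral_curveK 2 (LayerField 2 (m' + 3)) M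
      rw [he, ptLogΩ_add (m := m' + 3) (hcL (m' + 3)) hactL (hck (m' + 3)) hactk,
        ptLogΩ_act act (act_zero hV) (act_some hV) _ (norm_zCoord_lt_one_of_mem_kernel (hck (m' + 3))), hcΛ (m' + 3)]
      exact sprungEll_add_smul_sub_v_mem_adjoin_v hx0 m' hσ3
    -- `N₁ • Q` lies in the image of `E₁`
    have hQlayer : (toLoc hV).symm Q ∈ subfieldPoints (genFibΩ 2 M) (layer 2 (m' + 3)).toSubfield coeffs_mem_layer := by
      obtain ⟨τ₀, -, hτ₀⟩ := exists_inverter_mem_localLayerSubgroupOfEmb_two ι hκ (m' + 1)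
      exact (forall_smul_eq_iff_mem_subfieldPoints hV (m' + 3) Q).mp
        ((mem_localLayerPointsOfEmb_two_iff_stab W ι hκ hτ₀ Q).mp hQ).1
    have hNQk : (toLoc hV).symm (N₁ • Q) ∈ kernel (Valued.v (R := PadicAlgCl 2)) (genFibΩ 2 M) := by
      have h : N₁ • (toLoc hV).symm Q ∈ kernel (Valued.v (R := PadicAlgCl 2)) (genFibΩ 2 M) :=
        card_smul_mem_kernel_of_mem_subfieldPoints M hQlayer
      rw [← map_nsmul] at h
      exact @h
    have hNQn : toLoc hV ((toLoc hV).symm (N₁ • Q)) ∈ localLayerPointsOfEmb κ ι W (m' + 1) := by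
      rw [AddEquiv.apply_symm_apply]; exact AddSubgroup.nsmul_mem _ hQ N₁
    -- (GEN) for `N₁ • Q` with generator `e` (file V)
    obtain ⟨B, hB, P', hP', R, hR, hEq⟩ :=
      plusGen_kernel_two_sprung hV ι hκ hxb hi0 hj0 hij hlog (n := m' + 1) (by omega) htors heL' hek heℓ hNQk hNQn
    rw [AddEquiv.apply_symm_apply] at hEq
    rw [he_toLoc] at hB
    -- generator change `e ↦ d = N₁•e − 2•y_1` (odd `N₁`), then odd saturation
    have hc1 : toLoc hV (c 1) ∈ localLayerPointsOfEmb κ ι W (m' + 1 - 1) :=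
      localLayerPointsOfEmb_mono κ ι W (Nat.zero_le _) hy1L0
    have hedc : N₁ • (toLoc hV (c (m' + 3)) + σ (m' + 3) • toLoc hV (c (m' + 3))) =
        (N₁ • (toLoc hV (c (m' + 1 + 2)) + σ (m' + 1 + 2) • toLoc hV (c (m' + 1 + 2))) - 2 • toLoc hV (c 1)) +
          2 • toLoc hV (c 1) := by
      rw [sub_add_cancel]
    have hgen := plusGen_of_plusGen_generator_change_odd (G := absoluteGaloisGroup ℚ_[2])
      (H := localLayerPointsOfEmb κ ι W (m' + 1)) (H' := localLayerPointsOfEmb κ ι W (m' + 1 - 1))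
      (fun g _ hx ↦ Sprung2012.smul_mem_localLayerPointsOfEmb κ ι W _ g hx) hN₁odd hedc hc1 hQ
      ⟨B, hB, P', hP', R, hR, hEq⟩
    exact hgen
  · -- (NONDIV) `cneg ∉ 2E(ℚ₂)`
    intro b hb
    exact sprung_one_ne_two_nsmul hV hx0 hN₁odd hcL hck hcΛ ((mem_localLayerPointsOfEmb_zero_iff κ ι W b).mp hb)

end Summit.BirchSwinnertonDyer.BirchSwinnertonDyer.Theorems.SSHondaTwo

end
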